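import Literature.NumberTheory.GaloisRepresentations.UniformizerModulus
import Literature.NumberTheory.GaloisRepresentations.NormUniformizer
import Mathlib.NumberTheory.Padics.RingHoms
import HarnessLib

/-!
# `[ℤ_p : pℤ_p] = p` and `mod_{ℚ_p}(p) = p⁻¹`: the residue index and the Haar modulus of `p` on `ℚ_p`

Topic `NumberTheory/GaloisRepresentations`; namespace `Literature.NumberTheory.GaloisRepresentations.Ultrametric`
with the grouping sub-namespace `PadicUniformizer` (the prime example of `UniformizerModulus` /
`NormUniformizer`). For Mathlib's `ℚ_[p]` (`Padic`) and `ϖ = p`: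

* `varpi p : ℚ_[p]ˣ` — `p` as a unit (`varpi_val`, `norm_varpi_lt_one`), and `isUniformizer_varpi`: it is a
  norm uniformizer in the sense of `NormUniformizer.IsUniformizer` (`Padic.norm_eq_zpow_neg_valuation`);
* `unitBallEquiv : unitBall ℚ_[p] ≃+ ℤ_[p]` (Mathlib's `PadicInt` IS the subtype `‖x‖ ≤ 1`);
* `addSubgroupOf_piBall_eq_comap` — under it, `pℤ_p ∩ ℤ_p ↦ maximalIdeal ℤ_[p] = (p)`
  (`PadicInt.norm_le_pow_iff_mem_span_pow`, `PadicInt.maximalIdeal_eq_span_p`);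
* **`resIndex_padic : resIndex (varpi p) = p`** (`PadicInt.residueField : ℤ_[p]/(p) ≃+* ZMod p`,
  `Nat.card_zmod`), hence **`distribHaarChar_padic : distribHaarChar ℚ_[p] (varpi p) = (p : ℝ≥0)⁻¹`** —
  Weil's `mod_{ℚ_p}(p) = p⁻¹` as a theorem (via `distribHaarChar_uniformizer`).

Standard: A. Weil, *Basic Number Theory* (1967), Ch. I §4, Th. 6; F. Q. Gouvêa, *p-adic Numbers* (1997),
§3.3 [folklore]. Everything is proved (Mathlib + the two imported tree files). Novelty check (`lean search
--decl`, 2026-08-18): Mathlib has `Padic.norm_p`, `PadicInt.residueField`, no `distribHaarChar ℚ_[p]`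
evaluation; the tree has the abstract `distribHaarChar_uniformizer` only. Deliberately NOT here: matrix
coefficients / local integrals at `ℚ_p` (model-specific), finite extensions of `ℚ_p`.

## Provenance

Reproduced for the tree under the LEAN-IN-TREE rule (2026-08-18) from the pub-hodgecm cell's package files
`HodgeCM/PerL34/LocalFactors/PadicResIndex.lean` (first part: the five `unitBallEquiv` … `distribHaarChar_padic`
declarations; DAG-node prover #07 lineage, seat pv07 gen 2, gate run 25) and `…/SmokeDilation.lean` (`norm_p_pos'`,
`norm_p_lt_one'`, `p_ne_zero'`, `varpi`, `varpi_val`, `norm_varpi_lt_one`; same seat, gate run 24), statements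
and proofs verbatim except `LocalModulus.` ↦ the tree names (same namespace) and docstrings / tags; the lemma
`isUniformizer_varpi` is new glue (port by seat pv07 gen 5).
-/

set_option autoImplicit false

noncomputable section

open MeasureTheory Set Metric IsLocalRing
open scoped NNReal

namespace Literature.NumberTheory.GaloisRepresentations.Ultrametric

namespace PadicUniformizer

variable (p : ℕ) [hp : Fact p.Prime]

/-- `0 < ‖p‖_p`. [folklore] -/
theorem norm_p_pos' : 0 < ‖(p : ℚ_[p])‖ := by
  rw [Padic.norm_p]; have : (0 : ℝ) < p := by exact_mod_cast hp.out.pos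
  positivity

/-- `‖p‖_p < 1`. [folklore] -/
theorem norm_p_lt_one' : ‖(p : ℚ_[p])‖ < 1 := by
  rw [Padic.norm_p]; exact inv_lt_one_of_one_lt₀ (by exact_mod_cast hp.out.one_lt)

/-- `p ≠ 0` in `ℚ_p`. [folklore] -/
theorem p_ne_zero' : (p : ℚ_[p]) ≠ 0 := norm_pos_iff.mp (norm_p_pos' p)

/-- `ϖ = p` as a unit of `ℚ_p`. [folklore] -/
def varpi : ℚ_[p]ˣ := Units.mk0 (p : ℚ_[p]) (p_ne_zero' p)

/-- The underlying element of `varpi p` is `p`. [folklore] -/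
@[simp] theorem varpi_val : ((varpi p : ℚ_[p]ˣ) : ℚ_[p]) = p := rfl

/-- `‖ϖ‖ < 1` for `ϖ = p`. [folklore] -/
theorem norm_varpi_lt_one : ‖((varpi p : ℚ_[p]ˣ) : ℚ_[p])‖ < 1 := norm_p_lt_one' p

/-- `p` is a norm uniformizer of `ℚ_p`: every non-zero `x` has `‖x‖ = ‖p‖ᵏ` with `k = v_p(x)`. [folklore] -/
theorem isUniformizer_varpi : IsUniformizer (varpi p) := by
  refine ⟨norm_varpi_lt_one p, fun y => ⟨(y : ℚ_[p]).valuation, ?_⟩⟩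
  rw [varpi_val, Padic.norm_p, Padic.norm_eq_zpow_neg_valuation y.ne_zero, inv_zpow', zpow_neg]

/-- `𝒪 = {‖x‖ ≤ 1} ⊂ ℚ_p` as an additive group IS `ℤ_p`. [folklore] -/
def unitBallEquiv : (unitBall ℚ_[p]).toAddSubgroup ≃+ ℤ_[p] where
  toFun x := ⟨x.1, (mem_unitBall (K := ℚ_[p])).mp x.2⟩
  invFun z := ⟨z.1, (mem_unitBall (K := ℚ_[p])).mpr z.2⟩
  left_inv _ := rfl
  right_inv _ := rfl
  map_add' _ _ := rfl

/-- `unitBallEquiv` is the identity on underlying elements. [folklore] -/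
@[simp] theorem coe_unitBallEquiv (x : (unitBall ℚ_[p]).toAddSubgroup) :
    ((unitBallEquiv p x : ℤ_[p]) : ℚ_[p]) = (x : ℚ_[p]) := rfl

/-- Under `𝒪 ≃+ ℤ_p`, the subgroup `pℤ_p ∩ ℤ_p = {‖x‖ ≤ ‖p‖}` of `𝒪` is the maximal ideal `(p)`. [folklore] -/
theorem addSubgroupOf_piBall_eq_comap :
    ((piBall (varpi p) : OpenAddSubgroup ℚ_[p]).toAddSubgroup).addSubgroupOf
        (unitBall ℚ_[p]).toAddSubgroup
      = ((maximalIdeal ℤ_[p]).toAddSubgroup).comap (unitBallEquiv p).toAddMonoidHom := by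
  ext x
  rw [AddSubgroup.mem_addSubgroupOf, AddSubgroup.mem_comap]
  change (x : ℚ_[p]) ∈ piBall (varpi p) ↔ unitBallEquiv p x ∈ maximalIdeal ℤ_[p]
  rw [mem_piBall, PadicInt.maximalIdeal_eq_span_p, ← pow_one (p : ℤ_[p]),
    ← PadicInt.norm_le_pow_iff_mem_span_pow, varpi_val, Padic.norm_p]
  simp only [Nat.cast_one, zpow_neg, zpow_one]
  rfl

/-- **`[ℤ_p : pℤ_p] = p`.** [folklore] -/
theorem resIndex_padic : resIndex (varpi p) = p := by
  change (((piBall (varpi p) : OpenAddSubgroup ℚ_[p]).toAddSubgroup).addSubgroupOf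
    (unitBall ℚ_[p]).toAddSubgroup).index = p
  rw [addSubgroupOf_piBall_eq_comap,
    AddSubgroup.index_comap_of_surjective (f := (unitBallEquiv p).toAddMonoidHom) _
      (unitBallEquiv p).surjective,
    AddSubgroup.index_eq_card]
  change Nat.card (ResidueField ℤ_[p]) = p
  rw [Nat.card_congr (PadicInt.residueField (p := p)).toEquiv, Nat.card_zmod]

/-- **Weil's `mod_{ℚ_p}(p) = p⁻¹` as a theorem**: the Haar modulus of `p` acting on `ℚ_p`.
[cite: WeilBNT1967, Ch. I §4, Th. 6] -/
theorem distribHaarChar_padic : distribHaarChar ℚ_[p] (varpi p) = ((p : ℝ≥0))⁻¹ := by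
  rw [distribHaarChar_uniformizer (norm_varpi_lt_one p).le, resIndex_padic]

end PadicUniformizer

end Literature.NumberTheory.GaloisRepresentations.Ultrametric

end
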